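import Summits.BirchSwinnertonDyer.BirchSwinnertonDyer.Theorems.EisensteinPrimesMazurMCOnCellBTwistbackOrderOnePartner
import Summits.BirchSwinnertonDyer.BirchSwinnertonDyer.Theorems.EisensteinPrimesMultOrderOnePAdicGZ
import HarnessLib

/-!
# Crux 3 `MazurMCOnCellB` (stmt-BirchSwinnertonDyer-19033), line `twistback` v5 — roads (b)/(c′) WITHOUT Keller–Yin:
# the `L`-function-certificate doors `_of_padicGZ` (Disegni 2020 Thm. 2.4 in place of Thm. E)

Width seat bsd-line-x2-p1-w3 (g11), 2026-08-28; sequel of `…EisensteinPrimesMultOrderOnePAdicGZ` (this seat, p660855) over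
w5's `…TwistbackOrderOneRankOne` (p650915) and `…TwistbackOrderOnePartner` (p651350-series). HONEST FRAMING (cell `bsd-eis`,
run/shared/lean/pub/bsd-eis/): conditional theorems only; named facts BY NAME — the route's `PublishedInputs`
(stmt-…-19037: modularity, Hoffstein–Luo, Gross–Zagier, …), Disegni 2020 Thm. 4(1) (`padicBSD_rankOne_nonsplitMult`, PUB)
and Disegni 2020 Thm. 2.4 (`padicGrossZagier_nonsplitMult`, PUB, p660151) — NO preprint: the two theorems below are w5's
`_of_thmE` doors of the same names with `hDD` (Dokchitser–Dokchitser) + `hKY` (Keller–Yin Thm. E, PRE) REPLACED by the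
single `hDGZ`, the partner's analytic rank being read off the per-pair certificate `ord_{T=0} L_p(E^{(d_K)}, T) = 1` by
`…MultOrderOnePAdicGZ.analyticRank_eq_one_of_orderOne_of_padicGZ` (Perrin-Riou's argument with Disegni's `p`-adic
Gross–Zagier formula: no Selmer corank, no parity, no `p`-converse, no Wuthrich). WHY: road (b) of the LEAD's verdicts
(g11/g12 §2 (ii)) serves the 14 non-split A10 cells with `c(E) ≠ 1` through ONE admissible `K` per cell with the
certificate (a kit computation, JD pending); with this file that road's door is PUB + certificate only. No `def`, no
`sorry`; nothing about any curve is proved unconditionally; no main conjecture / BSD; 0 cells / labels / stubs / tiers move.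

* §1 `upperPartner_at_of_orderOne_partner_of_padicGZ` — w5's `…OrderOnePartner.upperPartner_at_of_orderOne_partner_of_thmE`.
* §2 `mazurMainConjectureAt_of_cellB_of_not_split_of_indexLowerBoundAt_of_orderOne_twist_of_padicGZ` — w5's
  `…OrderOneRankOne.mazurMainConjectureAt_…_of_orderOne_twist_of_thmE` (STEP L datum + certificate ⟹ Mazur's MC at the pair).

References: [Disegni2020] §2.2 Thm. 2.4, §3.2 Thm. 4; [SteinWuthrich2013] Thm. 6.1; [GreenbergVatsal2000] Thm. (1.3);
[PerrinRiou1987] §1.4; [HoffsteinLuo1997] Theorem; [GrossZagier1986] Thm. I.6.3; [SilvermanAEC2009] VIII.8 Cor. 8.3.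
-/

set_option autoImplicit false

-- `Summit.BirchSwinnertonDyer.BirchSwinnertonDyer.…`: the summit and its single sub-problem share a name.
set_option linter.dupNamespace false

noncomputable section

open scoped Classical MatrixGroups ModularForm

open CongruenceSubgroup WeierstrassCurve NumberField IsDedekindDomain Field
  Literature.NumberTheory.EllipticCurves
  Literature.NumberTheory.GaloisRepresentations
  Literature.NumberTheory.EllipticCurves.ModularForms
  Literature.NumberTheory.QuadraticFields
  Literature.NumberTheory.EllipticCurves.Rank1Residual
  Literature.NumberTheory.EllipticCurves.Rank1Residual.Typed
  Literature.NumberTheory.EllipticCurves.Disegni2020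
  Summit.BirchSwinnertonDyer.Rank1Residual
  Summit.BirchSwinnertonDyer.Rank1Residual.X2
  Summit.BirchSwinnertonDyer.BirchSwinnertonDyer.Theses
  Summit.BirchSwinnertonDyer.BirchSwinnertonDyer.Theorems.EisensteinPrimesMazurMCOnCellBTwistbackOnePartnerCertificates
  Summit.BirchSwinnertonDyer.BirchSwinnertonDyer.Theorems.EisensteinPrimesMazurMCOnCellBTwistbackLamOneRankOne
  Summit.BirchSwinnertonDyer.BirchSwinnertonDyer.Theorems.EisensteinPrimesMazurMCOnCellBTwistbackOrderOneRankOne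
  Summit.BirchSwinnertonDyer.BirchSwinnertonDyer.Theorems.EisensteinPrimesMultOrderOnePAdicGZ

namespace Summit.BirchSwinnertonDyer.BirchSwinnertonDyer.Theorems.EisensteinPrimesMazurMCOnCellBTwistbackOrderOnePartnerPAdicGZ

/-! ## §1. Road (c′)/(b), the DOOR: stub 6 at `(W, p)` from ONE admissible `K` with the certificate, PUBLISHED inputs only -/

/-- **Stub 6's conclusion AT ONE non-split X2b pair (VERBATIM shape) from ONE admissible `K` whose twist carries the
certificate `ord_{T=0} L_p(E^{(d_K)}, T) = 1`, the partner's analytic rank DERIVED from PUBLISHED inputs** — w5's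
`…OrderOnePartner.upperPartner_at_of_orderOne_partner_of_thmE` with `hDD` + `hKY` REPLACED by
`hDGZ : padicGrossZagier_nonsplitMult`: for a NON-split X2b pair `(W, p)` and ONE admissible `K` (imaginary quadratic,
Heegner for `N_W` and for `p`, `d_K` odd `< −4`) such that every globally minimal model `Wd` of `E^{(d_K)}` has
`ord_{T=0} L = 1` for THE non-split function of every newform/`ϖ` (`hordL`), the partner clause of `stub_upperPartner`
holds at `(W, p)` with this `K`: the twist is X2, non-split at `p`, `GVPar` (parity flip), of odd analytic rank
(`r_an(E) = 0`, Heegner sign), so `…MultOrderOnePAdicGZ` §4 (Perrin-Riou + Disegni + Hoffstein–Luo + Gross–Zagier)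
gives `r_an(Wd) = 1`, and p640749 §3(i) gives the upper half at every minimal model.
[cite: Disegni2020, §2.2 Thm. 2.4 and §3.2 Thm. 4] [cite: SteinWuthrich2013, Thm. 6.1 (p. 20), §4.2]
[cite: GreenbergVatsal2000, Thm. (1.3) with pp. 14–15] [cite: PerrinRiou1987, §1.4 Cor. 1.8] [cite: SilvermanAEC2009, VIII.8 Cor. 8.3] -/
theorem upperPartner_at_of_orderOne_partner_of_padicGZ (hP : EisensteinPrimes.PublishedInputs)
    (hDis : padicBSD_rankOne_nonsplitMult) (hDGZ : padicGrossZagier_nonsplitMult)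
    (W : WeierstrassCurve ℚ) [W.IsElliptic] [W.IsGloballyMinimal] (p : ℕ) [Fact p.Prime]
    (hc : X2.CellB W p) (hns : ¬ W.HasSplitMultiplicativeReductionAtPrime p)
    (K : Type) [Field K] [NumberField K] (hK : IsImaginaryQuadratic K)
    (hHN : SatisfiesHeegnerHypothesis (W.conductorNorm ℤ) K) (hHp : SatisfiesHeegnerHypothesis p K)
    (hodd : Odd (NumberField.discr K)) (hlt : NumberField.discr K < -4)
    (hordL : ∀ (Wd : WeierstrassCurve ℚ) [Wd.IsElliptic] [Wd.IsGloballyMinimal],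
      (∃ C : VariableChange ℚ, C • Wd = W.quadraticTwist (NumberField.discr K : ℚ)) →
      ∀ {M : ℕ} [NeZero M] (f : CuspForm (Gamma0 M) 2), IsNewformOf Wd f →
      ∀ (ϖ : ℚ), (ϖ : ℝ) * Wd.realPeriodRat = plusPeriod f →
      ∀ L : PowerSeries ℚ_[p], IsMultPAdicLFunctionOf f p (-1) L → L.order = ((1 : ℕ) : ℕ∞)) :
    ∃ (K : Type) (_ : Field K) (_ : NumberField K), IsImaginaryQuadratic K ∧
      SatisfiesHeegnerHypothesis (W.conductorNorm ℤ) K ∧ SatisfiesHeegnerHypothesis p K ∧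
      Odd (NumberField.discr K) ∧ NumberField.discr K < -4 ∧
      (W.quadraticTwist (NumberField.discr K : ℚ)).analyticRank = 1 ∧
      ∀ (Wd : WeierstrassCurve ℚ) [Wd.IsElliptic] [Wd.IsGloballyMinimal],
        (∃ C : VariableChange ℚ, C • Wd = W.quadraticTwist (NumberField.discr K : ℚ)) →
        MissingUpperBoundAt Wd p := by
  have hpar := hP.2.2.2.2.1
  have hnf := hP.2.2.2.2.2.1
  have hHL := hP.2.2.2.2.2.2.1
  have hGZ := hP.2.2.2.2.2.2.2.2.1
  have hpP : p.Prime := Fact.out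
  have hp2 : p ≠ 2 := hc.2.1.1
  have hred : ¬ W.HasIrreducibleModPGaloisRep p := hc.2.1.2.1
  have hmult : W.HasMultiplicativeReductionAtPrime p := hc.2.1.2.2
  have hr0 : W.analyticRank = 0 := hc.1
  have hdK : (NumberField.discr K : ℚ) ≠ 0 := by exact_mod_cast NumberField.discr_ne_zero K
  haveI := W.isElliptic_quadraticTwist hdK
  have hneg : NumberField.discr K < 0 := IsImaginaryQuadratic.discr_neg hK
  have hpd : ¬ (p : ℤ) ∣ NumberField.discr K := not_dvd_discr_of_split hK hpP hp2 hHp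
  -- every minimal model of the twist: X2, non-split, GVPar, odd analytic rank, hence `r_an = 1` and the upper half
  have hmodel : ∀ (Wd : WeierstrassCurve ℚ) [Wd.IsElliptic] [Wd.IsGloballyMinimal],
      (∃ C : VariableChange ℚ, C • Wd = W.quadraticTwist (NumberField.discr K : ℚ)) →
      Wd.analyticRank = (W.quadraticTwist (NumberField.discr K : ℚ)).analyticRank ∧ Wd.analyticRank = 1 ∧
        MissingUpperBoundAt Wd p := by
    intro Wd _ _ hWd
    obtain ⟨C, hC⟩ := hWd
    have hXd : ClassX2 Wd p := X2.classX2_twist W p hc.2.1 K hK hHp Wd ⟨C, hC⟩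
    have hgv : GVPar Wd p :=
      gvPar_of_not_gvPar_of_twist (W := W) (p := p) hp2 hred hc.2.2 hneg hpd Wd C (by simpa using hC)
    have hnsd : ¬ Wd.HasSplitMultiplicativeReductionAtPrime p := fun hs ↦
      hns ((X2.hasSplitMultiplicativeReductionAtPrime_iff_of_smul_eq_quadraticTwist W Wd hK p hp2 hmult hHp
        hC).mp hs)
    have hrd : Wd.analyticRank = (W.quadraticTwist (NumberField.discr K : ℚ)).analyticRank := by
      have h := congrArg WeierstrassCurve.analyticRank hC
      rwa [analyticRank_smul] at h
    have hoddd : Odd Wd.analyticRank := by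
      rw [hrd]
      exact EisensteinPrimesMazurMCOnCellBTwistbackLamOneRankOne.odd_analyticRank_quadraticTwist_of_analyticRank_eq_zero
        hnf W hr0 K hK hHN
    have h1 : Wd.analyticRank = 1 :=
      EisensteinPrimesMultOrderOnePAdicGZ.analyticRank_eq_one_of_orderOne_of_padicGZ hpar hnf hHL hGZ hDGZ Wd p hp2
        hXd.2.2 hnsd hoddd (hordL Wd ⟨C, hC⟩)
    exact ⟨hrd, h1, EisensteinPrimesMazurMCOnCellBTwistbackOnePartnerCertificates.missingUpperBoundAt_of_cellC_of_not_split_of_gvPar_of_orderOne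
      hP hDis Wd p ⟨h1, hXd⟩ hnsd hgv (hordL Wd ⟨C, hC⟩)⟩
  -- the twist has analytic rank `1` (read on any minimal model)
  obtain ⟨C₀, hC₀⟩ := hasGlobalMinimalModel_rat_holds (W.quadraticTwist (NumberField.discr K : ℚ))
  have hr1 : (W.quadraticTwist (NumberField.discr K : ℚ)).analyticRank = 1 := by
    haveI : (C₀ • W.quadraticTwist (NumberField.discr K : ℚ)).IsGloballyMinimal := hC₀
    obtain ⟨hrd, h1, -⟩ := hmodel (C₀ • W.quadraticTwist (NumberField.discr K : ℚ)) ⟨C₀⁻¹, inv_smul_smul C₀ _⟩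
    rw [← hrd, h1]
  exact ⟨K, inferInstance, inferInstance, hK, hHN, hHp, hodd, hlt, hr1, fun Wd _ _ hWd ↦ (hmodel Wd hWd).2.2⟩

/-! ## §2. PER PAIR, NON-SPLIT X2b: Mazur's MC from STEP L and the certificate — no `hrd`, PUBLISHED inputs only -/

/-- **PER PAIR, NON-SPLIT, `L`-function-certificate form WITHOUT the analytic rank of the partner, PUBLISHED inputs
only** — w5's `…OrderOneRankOne.mazurMainConjectureAt_of_cellB_of_not_split_of_indexLowerBoundAt_of_orderOne_twist_of_thmE`
with `hDD` + `hKY` REPLACED by `hDGZ : padicGrossZagier_nonsplitMult`: Mazur's main conjecture at a non-split X2b pair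
`(W, p)` from STEP L over `K` at ONE Heegner datum with `p ∤ c` (`hlow`) and ONE admissible `K` whose twist's minimal
model `Wd` carries `ord_{T=0} L_p(Wd, T) = 1` (`hordL`); the twist is non-split multiplicative at `p` of odd analytic
rank, so `…MultOrderOnePAdicGZ` §4 gives `hrd`, then p640749 §4 verbatim. [cite: Disegni2020, §2.2 Thm. 2.4 and §3.2 Thm. 4]
[cite: SteinWuthrich2013, Thm. 6.1 (p. 20), §4.2] [cite: GreenbergVatsal2000, Thm. (1.3) with pp. 14–15]
[cite: Wuthrich2014, Thm. 16 (p. 397)] [cite: JetchevSkinnerWan2017, §7.4.1] [cite: PerrinRiou1987, §1.4 Cor. 1.8] -/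
theorem mazurMainConjectureAt_of_cellB_of_not_split_of_indexLowerBoundAt_of_orderOne_twist_of_padicGZ
    (hP : EisensteinPrimes.PublishedInputs) (hDis : padicBSD_rankOne_nonsplitMult)
    (hDGZ : padicGrossZagier_nonsplitMult)
    (W : WeierstrassCurve ℚ) [W.IsElliptic] [W.IsGloballyMinimal] (p : ℕ) [Fact p.Prime]
    (hc : X2.CellB W p) (hns : ¬ W.HasSplitMultiplicativeReductionAtPrime p)
    (N : ℕ) [NeZero N] (K : Type) [Field K] [NumberField K]
    (Dt : ModularParametrizationData W N) (H : HeegnerDatum N (NumberField.discr K)) (ι : K →+* ℂ)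
    (P : (W.baseChange K).toAffine.Point)
    (hK : IsImaginaryQuadratic K) (hodd : Odd (NumberField.discr K)) (hlt : NumberField.discr K < -4)
    (hN : W.conductorNorm ℤ = N) (hHN : SatisfiesHeegnerHypothesis N K)
    (hHp : SatisfiesHeegnerHypothesis p K)
    (hPt : WeierstrassCurve.Affine.Point.map ι.toRatAlgHom P = heegnerPointComplex Dt H)
    (hcM : ¬ (p : ℤ) ∣ Dt.c)
    (Wd : WeierstrassCurve ℚ) [Wd.IsElliptic] [Wd.IsGloballyMinimal]
    (hWd : ∃ C : VariableChange ℚ, C • Wd = W.quadraticTwist (NumberField.discr K : ℚ))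
    (hlow : Finite (W.baseChange K).sha → X11b.IndexLowerBoundAt W p K P)
    (hordL : ∀ {M : ℕ} [NeZero M] (f : CuspForm (Gamma0 M) 2), IsNewformOf Wd f →
      ∀ (ϖ : ℚ), (ϖ : ℝ) * Wd.realPeriodRat = plusPeriod f →
      ∀ L : PowerSeries ℚ_[p], IsMultPAdicLFunctionOf f p (-1) L → L.order = ((1 : ℕ) : ℕ∞)) :
    X2.MazurMainConjectureAt W p := by
  have hpar := hP.2.2.2.2.1
  have hnf := hP.2.2.2.2.2.1
  have hHL := hP.2.2.2.2.2.2.1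
  have hGZ := hP.2.2.2.2.2.2.2.2.1
  have hp2 : p ≠ 2 := hc.2.1.1
  have hmult : W.HasMultiplicativeReductionAtPrime p := hc.2.1.2.2
  have hr0 : W.analyticRank = 0 := hc.1
  obtain ⟨C, hC⟩ := hWd
  have hXd : ClassX2 Wd p := X2.classX2_twist W p hc.2.1 K hK hHp Wd ⟨C, hC⟩
  have hnsd : ¬ Wd.HasSplitMultiplicativeReductionAtPrime p := fun hs ↦
    hns ((X2.hasSplitMultiplicativeReductionAtPrime_iff_of_smul_eq_quadraticTwist W Wd hK p hp2 hmult hHp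
      hC).mp hs)
  have hHW : SatisfiesHeegnerHypothesis (W.conductorNorm ℤ) K := by rw [hN]; exact hHN
  have hoddd : Odd Wd.analyticRank := by
    have h := congrArg WeierstrassCurve.analyticRank hC
    rw [analyticRank_smul] at h
    rw [h]
    exact EisensteinPrimesMazurMCOnCellBTwistbackLamOneRankOne.odd_analyticRank_quadraticTwist_of_analyticRank_eq_zero
      hnf W hr0 K hK hHW
  have hrd : Wd.analyticRank = 1 :=
    EisensteinPrimesMultOrderOnePAdicGZ.analyticRank_eq_one_of_orderOne_of_padicGZ hpar hnf hHL hGZ hDGZ Wd p hp2 hXd.2.2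
      hnsd hoddd hordL
  exact EisensteinPrimesMazurMCOnCellBTwistbackOnePartnerCertificates.mazurMainConjectureAt_of_cellB_of_not_split_of_indexLowerBoundAt_of_orderOne_twist
    hP hDis W p hc hns N K Dt H ι P hK hodd hlt hN hHN hHp hPt hcM Wd ⟨C, hC⟩ hrd hlow hordL

end Summit.BirchSwinnertonDyer.BirchSwinnertonDyer.Theorems.EisensteinPrimesMazurMCOnCellBTwistbackOrderOnePartnerPAdicGZ

end
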